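import Literature.AlgebraicTopology.SingularHomology.HomologySpheresProofs
import HarnessLib

/-!
# Universal coefficients with vanishing `Ext` term: `Hⁿ⁺¹(X; R) ≅ Hom_R(Hₙ₊₁(X; R), R)` and
`Hⁿ⁺¹(X; R)` is torsion-free when `Hₙ(X; R)` is free

A. Hatcher, *Algebraic Topology* (2002), §3.1, Thm. 3.2 (p. 195, with p. 197 over a principal
ideal domain `R` and pp. 198–199 for spaces): the Kronecker map
`h : Hⁿ⁺¹(X; R) → Hom_R(Hₙ₊₁(X; R), R)` is onto with kernel `Ext_R(Hₙ(X; R), R)`, and (p. 195)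
"`Ext(H, G) = 0` if `H` is free"; Cor. 3.3 (p. 196): for finitely generated homology
`Hⁿ ≅ (Hₙ / Tₙ) ⊕ Tₙ₋₁`, so the torsion of `Hⁿ⁺¹` is that of `Hₙ`.

The two halves are PROVED in the tree: surjectivity in all degrees
(`Literature.AlgebraicTopology.SingularHomology.kroneckerPairing_surjective`,
`UniversalCoefficientsProofs.lean`) and injectivity over a free `Hₙ(X; R)`
(`Literature.AlgebraicTopology.SingularHomology.injective_kroneckerPairing_of_free`,
`HomologySpheresProofs.lean`).  This short file only assembles the consequences used for closed
manifolds (no statement of those files is modified, nothing is asserted, no definition is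
introduced):

* `Literature.AlgebraicTopology.SingularHomology.kroneckerPairing_bijective_of_free` /
  `…_of_isZero`: `h` is bijective when `Hₙ(X; R)` is free, in particular when `Hₙ(X; R) = 0`
  (e.g. `n = 1` for a simply connected space: `H²(X; R) ≅ Hom_R(H₂(X; R), R)`);
* `Literature.AlgebraicTopology.SingularHomology.torsion_singularCohomology_eq_bot_of_free` /
  `…_of_isZero`: then `Hⁿ⁺¹(X; R)` is torsion-free, being embedded by `h` into a dual module,
  which over a domain has no torsion (`Literature.AlgebraicTopology.SingularHomology.torsion_dual_eq_bot`).

## References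

* A. Hatcher, *Algebraic Topology*, CUP 2002, §3.1, Thm. 3.2 (p. 195), p. 196 and Cor. 3.3,
  p. 197. [Hatcher2002]
-/

noncomputable section

open CategoryTheory Limits Submodule

universe u v

namespace Literature.AlgebraicTopology.SingularHomology

/-! ### Dual modules over a domain are torsion-free -/

section Algebra

variable {R : Type*} [CommRing R]

/-- A dual module over a domain is torsion-free: if `a • f = 0` with `a ≠ 0` then
`a * f m = 0`, so `f m = 0`, for all `m`. [folklore] -/
theorem torsion_dual_eq_bot [IsDomain R] {N : Type*} [AddCommGroup N] [Module R N] :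
    Submodule.torsion R (Module.Dual R N) = ⊥ := by
  rw [eq_bot_iff]
  intro f hf
  obtain ⟨⟨a, ha⟩, haf⟩ := (Submodule.mem_torsion_iff f).mp hf
  rw [Submodule.mem_bot]
  refine LinearMap.ext fun m => ?_
  have h : a * f m = 0 := by
    have := LinearMap.congr_fun haf m
    simpa using this
  exact (mul_eq_zero.mp h).resolve_left (nonZeroDivisors.ne_zero ha)

end Algebra

/-! ### The Kronecker map is bijective, and `Hⁿ⁺¹` torsion-free, when `Hₙ(X; R)` is free -/

section Free

variable (R : Type v) [CommRing R] [IsDomain R] [IsPrincipalIdealRing R]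
  (X : Type u) [TopologicalSpace X]

/-- **Universal coefficients with vanishing `Ext` term**: when `Hₙ(X; R)` is a free `R`-module,
the Kronecker map `h : Hⁿ⁺¹(X; R) → Hom_R(Hₙ₊₁(X; R), R)` is bijective (Hatcher 2002, §3.1,
Thm. 3.2, p. 195: split exact `0 → Ext(Hₙ, R) → Hⁿ⁺¹ → Hom(Hₙ₊₁, R) → 0` with `Ext(Hₙ, R) = 0`
for `Hₙ` free; p. 197 over a PID).  Assembled from the tree's proved halves
`injective_kroneckerPairing_of_free` and `kroneckerPairing_surjective`.
[cite: Hatcher2002, §3.1 Thm. 3.2 (p. 195)] -/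
theorem kroneckerPairing_bijective_of_free (n : ℕ) [Module.Free R (singularHomology R R X n)] :
    Function.Bijective (kroneckerPairing R R X (n + 1)) :=
  ⟨injective_kroneckerPairing_of_free R X n, kroneckerPairing_surjective R X (n + 1)⟩

/-- When `Hₙ(X; R) = 0` the Kronecker map `Hⁿ⁺¹(X; R) → Hom_R(Hₙ₊₁(X; R), R)` is bijective
(Hatcher 2002, §3.1, Thm. 3.2, the zero module being free); e.g. `n = 1` for a simply connected
space: `H²(X; R) ≅ Hom_R(H₂(X; R), R)`. [cite: Hatcher2002, §3.1 Thm. 3.2 (p. 195)] -/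
theorem kroneckerPairing_bijective_of_isZero (n : ℕ) (h : IsZero (singularHomology R R X n)) :
    Function.Bijective (kroneckerPairing R R X (n + 1)) := by
  haveI := ModuleCat.subsingleton_of_isZero h
  exact kroneckerPairing_bijective_of_free R X n

/-- **`Hⁿ⁺¹(X; R)` is torsion-free when `Hₙ(X; R)` is free** (Hatcher 2002, §3.1, Cor. 3.3 and
p. 196: the torsion of `Hⁿ⁺¹` is `Ext(Hₙ, R) ≅ T(Hₙ)`, which vanishes for `Hₙ` free): the
Kronecker map embeds `Hⁿ⁺¹(X; R)` (`injective_kroneckerPairing_of_free`) into the torsion-free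
module `Hom_R(Hₙ₊₁(X; R), R)` (`torsion_dual_eq_bot`). [cite: Hatcher2002, §3.1 Cor. 3.3 (p. 196)] -/
theorem torsion_singularCohomology_eq_bot_of_free (n : ℕ) [Module.Free R (singularHomology R R X n)] :
    Submodule.torsion R (singularCohomology R R X (n + 1)) = ⊥ := by
  rw [eq_bot_iff]
  intro a ha
  rw [Submodule.mem_bot]
  refine injective_kroneckerPairing_of_free R X n ?_
  rw [map_zero]
  obtain ⟨r, hr⟩ := (Submodule.mem_torsion_iff a).mp ha
  rw [Submonoid.smul_def] at hr
  have h : kroneckerPairing R R X (n + 1) a ∈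
      Submodule.torsion R (Module.Dual R (singularHomology R R X (n + 1))) :=
    (Submodule.mem_torsion_iff _).mpr ⟨r, by rw [Submonoid.smul_def, ← map_smul, hr, map_zero]⟩
  rwa [torsion_dual_eq_bot, Submodule.mem_bot] at h

/-- When `Hₙ(X; R) = 0`, `Hⁿ⁺¹(X; R)` is torsion-free (Hatcher 2002, §3.1, Cor. 3.3); e.g.
`H²(X; ℤ)` of a simply connected space has no torsion. [cite: Hatcher2002, §3.1 Cor. 3.3 (p. 196)] -/
theorem torsion_singularCohomology_eq_bot_of_isZero (n : ℕ) (h : IsZero (singularHomology R R X n)) :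
    Submodule.torsion R (singularCohomology R R X (n + 1)) = ⊥ := by
  haveI := ModuleCat.subsingleton_of_isZero h
  exact torsion_singularCohomology_eq_bot_of_free R X n

end Free

end Literature.AlgebraicTopology.SingularHomology

end
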